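import Mathlib
import Literature.MathematicalPhysics.QuantumLattice.GibbsStationaritySlack

/-!
# hub-lb-idea-7 g0 — Sketch: first lemmas of the two declared lines

* LINE idea7-L1 «LKKT» (seam-free / layer KKT rows): the single-unitary ground-state stability row
  `0 ≤ Re ⟨ψ, (Uᴴ H U − H) ψ⟩` (PROVED below from the tree's KKT row), plus the light-cone
  bookkeeping statement that makes a translation-invariant LAYER of commuting gates a finite row.
* LINE idea7-L2 «WGEC» (word-Gibbs entropy cuts): the tangent (data-processing) inequality
  `S(ρ_AB) − S(ρ_A) ≤ Re Tr ρ_AB (log σ_A ⊗ 1 − log σ_AB)` for every full-rank reference σ_AB,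
  stated as a named Prop over a CFC-defined von Neumann entropy (Lindblad 1975 monotonicity).
-/

namespace HubLbIdea7

open Matrix Literature.MathematicalPhysics.QuantumLattice
open scoped ComplexOrder

variable {n : Type*} [Fintype n] [DecidableEq n]

/-- **LKKT first lemma (proved).** A ground-state vector is stable under conjugation of the
Hamiltonian by ANY unitary: `0 ≤ Re ⟨ψ, (Uᴴ H U − H) ψ⟩`. This is the tree's KKT row
`re_dotProduct_conjTranspose_comm_mulVec_nonneg_of_isGroundStateVector` at the word `A := U`,
using `Uᴴ(HU − UH) = UᴴHU − H`. The layer row of the line is this inequality for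
`U = ∏ gates` on the `L×L` torus, made finite by the light-cone identity below and divided by `L²`. -/
theorem re_dotProduct_unitaryConj_sub_mulVec_nonneg {H : Matrix n n ℂ} (hH : H.IsHermitian)
    {ψ : n → ℂ} (hψ : H.IsGroundStateVector ψ) {U : Matrix n n ℂ} (hU : Uᴴ * U = 1) :
    0 ≤ (star ψ ⬝ᵥ (Uᴴ * H * U - H) *ᵥ ψ).re := by
  have h := re_dotProduct_conjTranspose_comm_mulVec_nonneg_of_isGroundStateVector hH hψ U
  have hrw : Uᴴ * (H * U - U * H) = Uᴴ * H * U - H := by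
    rw [Matrix.mul_sub, ← Matrix.mul_assoc, ← Matrix.mul_assoc, hU, Matrix.one_mul]
  rw [hrw] at h
  exact h

/-- **LKKT light-cone bookkeeping (proved, two-gate case).** If two gates commute, the second is
unitary and commutes with the local term `h`, then conjugating `h` by the product equals conjugating
by the first gate alone. Inductively: a translation-invariant layer `U = ∏ₓ gₓ` of pairwise commuting
gates dresses each bond term only by the finitely many gates in its light cone, so
`⟨Uᴴ H U − H⟩/L² = Σ_{b ∈ cell} ⟨U_bᴴ h_b U_b − h_b⟩` is a FINITE linear row in window moments. -/
theorem conj_mul_eq_conj_of_commute {m : Type*} [Fintype m] [DecidableEq m]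
    (h g₁ g₂ : Matrix m m ℂ) (hcomm : g₁ * g₂ = g₂ * g₁) (hh : g₂ * h = h * g₂)
    (hU : g₂ᴴ * g₂ = 1) (hU' : g₂ * g₂ᴴ = 1) :
    (g₁ * g₂)ᴴ * h * (g₁ * g₂) = g₁ᴴ * h * g₁ := by
  -- g₂ commutes with g₁ᴴ (two-sided unitarity) and with h, so it cancels against g₂ᴴ.
  have hc' : g₂ * g₁ᴴ = g₁ᴴ * g₂ := by
    have := congrArg (fun M => g₂ * M * g₂) (congrArg Matrix.conjTranspose hcomm)
    -- (g₁ g₂)ᴴ = g₂ᴴ g₁ᴴ and (g₂ g₁)ᴴ = g₁ᴴ g₂ᴴ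
    simp only [Matrix.conjTranspose_mul] at this
    -- this : g₂ * (g₂ᴴ * g₁ᴴ) * g₂ = g₂ * (g₁ᴴ * g₂ᴴ) * g₂
    calc g₂ * g₁ᴴ = g₂ * g₁ᴴ * (g₂ᴴ * g₂) := by rw [hU, Matrix.mul_one]
      _ = g₂ * (g₁ᴴ * g₂ᴴ) * g₂ := by
            simp only [Matrix.mul_assoc]
      _ = g₂ * (g₂ᴴ * g₁ᴴ) * g₂ := this.symm
      _ = (g₂ * g₂ᴴ) * g₁ᴴ * g₂ := by simp only [Matrix.mul_assoc]
      _ = g₁ᴴ * g₂ := by rw [hU', Matrix.one_mul]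
  calc (g₁ * g₂)ᴴ * h * (g₁ * g₂)
      = g₂ᴴ * g₁ᴴ * h * g₁ * g₂ := by
          rw [Matrix.conjTranspose_mul]; simp only [Matrix.mul_assoc]
    _ = g₂ᴴ * (g₁ᴴ * h * g₁ * g₂) := by simp only [Matrix.mul_assoc]
    _ = g₂ᴴ * (g₂ * (g₁ᴴ * h * g₁)) := by
          congr 1
          calc g₁ᴴ * h * g₁ * g₂ = g₁ᴴ * h * (g₁ * g₂) := by simp only [Matrix.mul_assoc]
            _ = g₁ᴴ * h * (g₂ * g₁) := by rw [hcomm]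
            _ = g₁ᴴ * (h * g₂) * g₁ := by simp only [Matrix.mul_assoc]
            _ = g₁ᴴ * (g₂ * h) * g₁ := by rw [hh]
            _ = (g₁ᴴ * g₂) * h * g₁ := by simp only [Matrix.mul_assoc]
            _ = (g₂ * g₁ᴴ) * h * g₁ := by rw [hc']
            _ = g₂ * (g₁ᴴ * h * g₁) := by simp only [Matrix.mul_assoc]
    _ = (g₂ᴴ * g₂) * (g₁ᴴ * h * g₁) := by simp only [Matrix.mul_assoc]
    _ = g₁ᴴ * h * g₁ := by rw [hU, Matrix.one_mul]

/-! ### WGEC: von Neumann entropy via the continuous functional calculus and the tangent cut -/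

/-- Partial trace over the right tensor factor. -/
def ptraceRight {a b : Type*} [Fintype a] [Fintype b] (ρ : Matrix (a × b) (a × b) ℂ) :
    Matrix a a ℂ :=
  fun i j => ∑ k, ρ (i, k) (j, k)

/-- von Neumann entropy `S(ρ) = −Tr ρ log ρ` (natural log; `log` by the real CFC on Hermitian
matrices, `log 0 = 0` so the kernel contributes nothing). -/
noncomputable def vnEntropy {m : Type*} [Fintype m] [DecidableEq m] (ρ : Matrix m m ℂ) : ℝ :=
  -(Matrix.trace (ρ * cfc Real.log ρ)).re

/-- **WGEC first lemma (named fact, Lindblad 1975 / data processing for the partial trace).**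
For every density matrix `ρ_AB` and every FULL-RANK reference state `σ_AB`,
`S(ρ_AB) − S(ρ_A) ≤ Re Tr ρ_AB (log σ_A ⊗ 1_B − log σ_AB)`
(`= [S(ρ)+D(ρ‖σ)] − [S(ρ_A)+D(ρ_A‖σ_A)]` and `D(ρ_A‖σ_A) ≤ D(ρ‖σ)`).
Consequence used by the line: if `ρ_AB` is the `AB`-marginal of a translation-invariant state
(so `S(ρ_AB) ≥ S(ρ_A)` by weak monotonicity + translation invariance) then the LINEAR row
`Re Tr ρ_AB K_σ ≥ 0`, `K_σ := log σ_A ⊗ 1 − log σ_AB`, holds for EVERY full-rank `σ`; the line takes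
`σ = exp(−Λ_A ⊗ 1 − Σ_k β_k X_k)/Z` over the program's own words `X_k` on `AB` (word-Gibbs family). -/
def CondEntropyTangentCut : Prop :=
  ∀ {a b : Type} [Fintype a] [Fintype b] [DecidableEq a] [DecidableEq b]
    (ρ σ : Matrix (a × b) (a × b) ℂ), ρ.PosSemidef → ρ.trace = 1 → σ.PosDef → σ.trace = 1 →
    vnEntropy ρ - vnEntropy (ptraceRight ρ) ≤
      (Matrix.trace (ρ * (Matrix.kroneckerMap (fun x y => x * y) (cfc Real.log (ptraceRight σ))
        (1 : Matrix b b ℂ) - cfc Real.log σ))).re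

/-- The row the WGEC line files, as a statement about one window marginal: entropy monotonicity of
the marginal (the extendability input) implies the tangent row for every full-rank reference. -/
theorem wgec_row_of_monotone_of_tangent (hT : CondEntropyTangentCut)
    {a b : Type} [Fintype a] [Fintype b] [DecidableEq a] [DecidableEq b]
    (ρ σ : Matrix (a × b) (a × b) ℂ) (hρ : ρ.PosSemidef) (hρ1 : ρ.trace = 1) (hσ : σ.PosDef)
    (hσ1 : σ.trace = 1) (hmono : vnEntropy (ptraceRight ρ) ≤ vnEntropy ρ) :
    0 ≤ (Matrix.trace (ρ * (Matrix.kroneckerMap (fun x y => x * y) (cfc Real.log (ptraceRight σ))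
        (1 : Matrix b b ℂ) - cfc Real.log σ))).re := by
  have h := hT ρ σ hρ hρ1 hσ hσ1
  linarith

end HubLbIdea7
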